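import Literature.NumberTheory.Transcendental.UnivExtThetaPoints
import HarnessLib

/-!
# The theta model of `E♮`: the chart at the origin of `E` and its differential equations

Topic: `Literature/NumberTheory/Transcendental`. Plan item W4a of the unit
`provefact-Literature.NumberTheory.Transcendental.H-b596640137` (fact
`Literature.NumberTheory.Transcendental.HuberWustholzOnePeriods`). Baker's method on the groups
`M_κ` (Baker–Wüstholz 2007, §6.8) expresses the Taylor coefficients of a form `P(Θ)` at the points
`s·γ` through an affine chart of the projective embedding at those points, and uses that the
invariant derivations act on the chart ring by POLYNOMIAL formulas (the differential operators
`T_g ∘ 𝒟` of op. cit. §6.7 "do not depend on the choice" and preserve `R`). The points `s·γ` of the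
seven-period problem have torsion image in `E^γ`, so they meet the divisor over `0 ∈ E`, where the
affine coordinates `(℘, ℘′, ν)` have poles. This file sets up the **chart of `E♮` at the fibre over
`0 ∈ E`**, in which the non-vanishing coordinate is `Θ_{inl 2} = P₂ = σ³℘′`
(`PeriodPair.exists_univExtTheta_lattice`), through the three block ratios

* `u = P₀/P₂` (`= 1/℘′`), `p = P₁/P₂` (`= ℘/℘′`), `g = Z₂/P₂` (`= ζ + 2℘²/℘′`)
  (`PeriodPair.latU`, `latP`, `latG`),

meromorphic functions on `ℂ` that are ANALYTIC wherever `P₂ ≠ 0`, in particular at all lattice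
points, where `u = p = 0` and `g(λ) = η(λ)` (`latU/latP/latG_lattice`). The main results are the
**differential equations of the chart** (`hasDerivAt_latU/latP/latG`): wherever `P₂(z) ≠ 0`,

`u′ = -6p² + (g₂/2)u²`, `p′ = -1/2 - g₂pu - (3g₃/2)u²`, `g′ = -2g₂p² - 3g₃pu`,

polynomial in `u, p` with coefficients in `ℚ(g₂, g₃)` — obtained off the lattice from
`℘″ = 6℘² - g₂/2`, `ζ′ = -℘` and the Weierstrass equation `℘′² = 4℘³ - g₂℘ - g₃` (in the form
`℘³/℘′² = 1/4 + (g₂/4)pu + (g₃/4)u²`), and AT the lattice points by continuity (both sides are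
continuous and agree on a punctured neighbourhood), so that no Laurent coefficients of `σ` are
needed. In this chart the theta functions of `E♮` read
`Θ/P₂ = (u, p, 1, (t - g)u + 2p², (t - g)p + 1/2 + (g₂/2)pu + (g₃/2)u², t - g)` and `∂_t` acts by
`(0, 0, 0, u, p, 1)`; these identities follow in the sequel.

## References

* A. Baker, G. Wüstholz, *Logarithmic Forms and Diophantine Geometry*, CUP 2007, §6.7 (pp. 112–113:
  the operators `T_g`, `𝒟` on `R`), §6.8.
* E. T. Whittaker, G. N. Watson, *A Course of Modern Analysis*, §20.22 (`℘″ = 6℘² - g₂/2`), §20.4.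
-/

noncomputable section

open Complex Filter Topology
open scoped PeriodPair

namespace Literature.NumberTheory.Transcendental

variable (L : PeriodPair)

/-! ### The chart functions -/

/-- `u = P₀/P₂` (`= 1/℘′` off the lattice): first coordinate of the chart of `E♮` at the fibre over
`0 ∈ E`. [folklore] -/
def _root_.PeriodPair.latU (z : ℂ) : ℂ := L.univExtP 0 z / L.univExtP 2 z

/-- `p = P₁/P₂` (`= ℘/℘′` off the lattice). [folklore] -/
def _root_.PeriodPair.latP (z : ℂ) : ℂ := L.univExtP 1 z / L.univExtP 2 z

/-- `g = Z₂/P₂` (`= ζ + 2℘²/℘′` off the lattice, `= η(λ)` at `λ ∈ Λ`): the regularised `ζ` of the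
chart at the fibre over `0 ∈ E` (`ν - 2℘²/℘′ = t - g`). [folklore] -/
def _root_.PeriodPair.latG (z : ℂ) : ℂ := L.univExtZ 2 z / L.univExtP 2 z

variable {L}

/-- Off the lattice, `P₂(z) ≠ 0` forces `℘′(z) ≠ 0` (`P₂ = σ³℘′`). [folklore] -/
theorem _root_.PeriodPair.derivWeierstrassP_ne_zero_of_univExtP_two {z : ℂ} (hz : z ∉ L.lattice)
    (h2 : L.univExtP 2 z ≠ 0) : ℘'[L] z ≠ 0 := by
  rw [(PeriodPair.univExtP_eq hz).2.2] at h2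
  exact right_ne_zero_of_mul h2

/-- **Off the lattice `u = 1/℘′`, `p = ℘/℘′`, `g = ζ + 2℘²/℘′`** (where `P₂ ≠ 0`). [folklore] -/
theorem _root_.PeriodPair.latU_latP_latG_eq {z : ℂ} (hz : z ∉ L.lattice) (h2 : L.univExtP 2 z ≠ 0) :
    L.latU z = (℘'[L] z)⁻¹ ∧ L.latP z = ℘[L] z / ℘'[L] z ∧
    L.latG z = L.weierstrassZeta z + 2 * ℘[L] z ^ 2 / ℘'[L] z := by
  have h℘' := PeriodPair.derivWeierstrassP_ne_zero_of_univExtP_two hz h2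
  have hσ : L.weierstrassSigma z ≠ 0 := L.weierstrassSigma_ne_zero hz
  obtain ⟨p0, p1, p2⟩ := PeriodPair.univExtP_eq hz
  obtain ⟨-, -, z2⟩ := PeriodPair.univExtZ_eq hz
  simp only [PeriodPair.latU, PeriodPair.latP, PeriodPair.latG, p0, p1, p2, z2]
  refine ⟨?_, ?_, ?_⟩
  · field_simp
  · field_simp
  · field_simp

/-- **At lattice points `u = 0`, `p = 0`, `g = η(λ)`** (`λ = mω₁ + nω₂`, `η(λ) = mη₁ + nη₂`), and
`P₂(λ) ≠ 0`. [folklore] -/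
theorem _root_.PeriodPair.latU_latP_latG_lattice (L : PeriodPair) (m n : ℤ) :
    L.univExtP 2 (m * L.ω₁ + n * L.ω₂) ≠ 0 ∧ L.latU (m * L.ω₁ + n * L.ω₂) = 0 ∧
    L.latP (m * L.ω₁ + n * L.ω₂) = 0 ∧ L.latG (m * L.ω₁ + n * L.ω₂) = m * L.η₁ + n * L.η₂ := by
  obtain ⟨c, hc, v0, v1, v2, -, -, v5⟩ := L.exists_univExtTheta_lattice m n 0
  simp only [PeriodPair.univExtTheta_inl, PeriodPair.univExtTheta_inr, zero_mul, zero_sub] at v0 v1 v2 v5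
  have hP2 : L.univExtP 2 (m * L.ω₁ + n * L.ω₂) ≠ 0 := by rw [v2]; exact mul_ne_zero hc (by norm_num)
  refine ⟨hP2, ?_, ?_, ?_⟩
  · simp [PeriodPair.latU, v0]
  · simp [PeriodPair.latP, v1]
  · rw [PeriodPair.latG, div_eq_iff hP2, v2]
    linear_combination -v5

/-! ### Analyticity where `P₂ ≠ 0` -/

/-- The blocks are analytic (entire). [folklore] -/
theorem _root_.PeriodPair.analyticAt_univExtP (L : PeriodPair) (i : Fin 3) (z : ℂ) :
    AnalyticAt ℂ (L.univExtP i) z :=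
  (L.differentiable_univExtP i).analyticAt z

/-- The companions are analytic (entire). [folklore] -/
theorem _root_.PeriodPair.analyticAt_univExtZ (L : PeriodPair) (i : Fin 3) (z : ℂ) :
    AnalyticAt ℂ (L.univExtZ i) z :=
  (L.differentiable_univExtZ i).analyticAt z

/-- `u` is analytic wherever `P₂ ≠ 0`. [folklore] -/
theorem _root_.PeriodPair.analyticAt_latU {z : ℂ} (h2 : L.univExtP 2 z ≠ 0) : AnalyticAt ℂ L.latU z :=
  (L.analyticAt_univExtP 0 z).div (L.analyticAt_univExtP 2 z) h2

/-- `p` is analytic wherever `P₂ ≠ 0`. [folklore] -/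
theorem _root_.PeriodPair.analyticAt_latP {z : ℂ} (h2 : L.univExtP 2 z ≠ 0) : AnalyticAt ℂ L.latP z :=
  (L.analyticAt_univExtP 1 z).div (L.analyticAt_univExtP 2 z) h2

/-- `g` is analytic wherever `P₂ ≠ 0`. [folklore] -/
theorem _root_.PeriodPair.analyticAt_latG {z : ℂ} (h2 : L.univExtP 2 z ≠ 0) : AnalyticAt ℂ L.latG z :=
  (L.analyticAt_univExtZ 2 z).div (L.analyticAt_univExtP 2 z) h2

/-- Near a point where `P₂ ≠ 0`, `P₂` stays non-zero. [folklore] -/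
theorem _root_.PeriodPair.eventually_univExtP_two_ne_zero {z : ℂ} (h2 : L.univExtP 2 z ≠ 0) :
    ∀ᶠ w in 𝓝 z, L.univExtP 2 w ≠ 0 :=
  (L.differentiable_univExtP 2).continuous.continuousAt.eventually_ne h2

/-! ### The differential equations off the lattice -/

/-- The three chart equations at a non-lattice point with `P₂ ≠ 0` (i.e. `℘′ ≠ 0`), from
`℘″ = 6℘² - g₂/2`, `ζ′ = -℘` and `℘′² = 4℘³ - g₂℘ - g₃`. [folklore] -/
theorem _root_.PeriodPair.hasDerivAt_lat_of_notMem {z : ℂ} (hz : z ∉ L.lattice)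
    (h2 : L.univExtP 2 z ≠ 0) :
    HasDerivAt L.latU (-6 * L.latP z ^ 2 + L.g₂ / 2 * L.latU z ^ 2) z ∧
    HasDerivAt L.latP (-1 / 2 - L.g₂ * L.latP z * L.latU z - 3 * L.g₃ / 2 * L.latU z ^ 2) z ∧
    HasDerivAt L.latG (-2 * L.g₂ * L.latP z ^ 2 - 3 * L.g₃ * L.latP z * L.latU z) z := by
  have h℘' := PeriodPair.derivWeierstrassP_ne_zero_of_univExtP_two hz h2
  -- the chart functions agree with `1/℘′, ℘/℘′, ζ + 2℘²/℘′` near `z`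
  have hnear : ∀ᶠ w in 𝓝 z, w ∉ L.lattice ∧ L.univExtP 2 w ≠ 0 := by
    filter_upwards [L.isClosed_lattice.isOpen_compl.mem_nhds hz,
      PeriodPair.eventually_univExtP_two_ne_zero h2] with w hw hw2
    exact ⟨hw, hw2⟩
  have eqU : (fun w => (℘'[L] w)⁻¹) =ᶠ[𝓝 z] L.latU := by
    filter_upwards [hnear] with w hw using ((PeriodPair.latU_latP_latG_eq hw.1 hw.2).1).symm
  have eqP : (fun w => ℘[L] w / ℘'[L] w) =ᶠ[𝓝 z] L.latP := by
    filter_upwards [hnear] with w hw using ((PeriodPair.latU_latP_latG_eq hw.1 hw.2).2.1).symm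
  have eqG : (fun w => L.weierstrassZeta w + 2 * ℘[L] w ^ 2 / ℘'[L] w) =ᶠ[𝓝 z] L.latG := by
    filter_upwards [hnear] with w hw using ((PeriodPair.latU_latP_latG_eq hw.1 hw.2).2.2).symm
  obtain ⟨eu, ep, eg⟩ := PeriodPair.latU_latP_latG_eq hz h2
  have hP := PeriodPair.hasDerivAt_weierstrassP hz
  have hP' := L.hasDerivAt_derivWeierstrassP hz
  have hζ := PeriodPair.hasDerivAt_weierstrassZeta hz
  have hcurve := L.derivWeierstrassP_sq z hz
  have hsq : HasDerivAt (fun w => ℘[L] w ^ 2) (2 * ℘[L] z * ℘'[L] z) z := by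
    have h : HasDerivAt (fun w => ℘[L] w * ℘[L] w) (℘'[L] z * ℘[L] z + ℘[L] z * ℘'[L] z) z :=
      hP.mul hP
    simp only [← pow_two] at h
    convert h using 1
    ring
  refine ⟨?_, ?_, ?_⟩
  · -- `u = 1/℘′`
    have h := hP'.inv h℘'
    refine (h.congr_of_eventuallyEq eqU.symm).congr_deriv ?_
    rw [eu, ep]
    field_simp
    ring
  · -- `p = ℘/℘′`
    have h := hP.div hP' h℘'
    refine (h.congr_of_eventuallyEq eqP.symm).congr_deriv ?_
    rw [eu, ep]
    field_simp
    linear_combination (3 : ℂ) * hcurve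
  · -- `g = ζ + 2℘²/℘′`
    have h := hζ.add ((hsq.const_mul 2).div hP' h℘')
    refine (h.congr_of_eventuallyEq eqG.symm).congr_deriv ?_
    rw [eu, ep]
    field_simp
    linear_combination (3 : ℂ) * ℘[L] z * hcurve

/-! ### The differential equations at every point of the chart (continuity at lattice points) -/

/-- Near any point, punctured, there are no lattice points (`Λ` is discrete); the tree's
`PeriodPair.eventually_nhdsNE_notMem_lattice` is the case of the origin. [folklore] -/
theorem _root_.PeriodPair.eventually_nhdsNE_notMem_lattice_at (L : PeriodPair) (z : ℂ) :
    ∀ᶠ w in 𝓝[≠] z, w ∉ L.lattice := by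
  have h1 : ∀ᶠ w in 𝓝[≠] z, w ∈ (L.lattice \ {z} : Set ℂ)ᶜ :=
    mem_nhdsWithin_of_mem_nhds (L.compl_lattice_sdiff_singleton_mem_nhds z)
  filter_upwards [h1, self_mem_nhdsWithin] with w hw hwz
  simp only [Set.mem_compl_iff, Set.mem_sdiff, SetLike.mem_coe, Set.mem_singleton_iff, not_and,
    not_not] at hw
  exact fun h => hwz (hw h)

/-- **Uniqueness of limits transfers a derivative identity across an isolated point.** If `F` is
analytic at `z`, `Q` is continuous at `z`, and `deriv F = Q` on a punctured neighbourhood of `z`,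
then `HasDerivAt F (Q z) z`. [folklore] -/
theorem hasDerivAt_of_deriv_eq_nhdsNE {F Q : ℂ → ℂ} {z : ℂ} (hF : AnalyticAt ℂ F z)
    (hQ : ContinuousAt Q z) (h : ∀ᶠ w in 𝓝[≠] z, deriv F w = Q w) : HasDerivAt F (Q z) z := by
  have hd : HasDerivAt F (deriv F z) z := hF.differentiableAt.hasDerivAt
  have hcd : ContinuousAt (deriv F) z := (hF.deriv).continuousAt
  have h1 : Tendsto (deriv F) (𝓝[≠] z) (𝓝 (deriv F z)) :=
    Filter.Tendsto.mono_left hcd.tendsto nhdsWithin_le_nhds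
  have h2' : Tendsto Q (𝓝[≠] z) (𝓝 (Q z)) := Filter.Tendsto.mono_left hQ.tendsto nhdsWithin_le_nhds
  have heq : Q =ᶠ[𝓝[≠] z] deriv F := h.mono fun w hw => hw.symm
  have h2 : Tendsto (deriv F) (𝓝[≠] z) (𝓝 (Q z)) := h2'.congr' heq
  have key : deriv F z = Q z := tendsto_nhds_unique h1 h2
  rw [← key]
  exact hd

/-- **The chart equations `u′ = -6p² + (g₂/2)u²`, `p′ = -1/2 - g₂pu - (3g₃/2)u²`,
`g′ = -2g₂p² - 3g₃pu` hold at EVERY point with `P₂ ≠ 0`**, lattice points included (there by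
continuity from the punctured neighbourhood, on which the point is off the lattice and `P₂ ≠ 0`).
[cite: BakerWustholz2007, §6.7 (pp. 112–113: the invariant differential operators act on R)] -/
theorem _root_.PeriodPair.hasDerivAt_lat {z : ℂ} (h2 : L.univExtP 2 z ≠ 0) :
    HasDerivAt L.latU (-6 * L.latP z ^ 2 + L.g₂ / 2 * L.latU z ^ 2) z ∧
    HasDerivAt L.latP (-1 / 2 - L.g₂ * L.latP z * L.latU z - 3 * L.g₃ / 2 * L.latU z ^ 2) z ∧
    HasDerivAt L.latG (-2 * L.g₂ * L.latP z ^ 2 - 3 * L.g₃ * L.latP z * L.latU z) z := by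
  by_cases hz : z ∈ L.lattice
  swap
  · exact PeriodPair.hasDerivAt_lat_of_notMem hz h2
  -- at a lattice point: the identities hold on a punctured neighbourhood
  have hne : ∀ᶠ w in 𝓝[≠] z, w ∉ L.lattice ∧ L.univExtP 2 w ≠ 0 :=
    (L.eventually_nhdsNE_notMem_lattice_at z).and
      ((PeriodPair.eventually_univExtP_two_ne_zero h2).filter_mono nhdsWithin_le_nhds)
  have hU := PeriodPair.analyticAt_latU h2
  have hPa := PeriodPair.analyticAt_latP h2
  have hG := PeriodPair.analyticAt_latG h2
  have hu := hU.continuousAt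
  have hp := hPa.continuousAt
  -- the right-hand sides are continuous at `z`
  have hc0 : ContinuousAt (fun w => -6 * L.latP w ^ 2 + L.g₂ / 2 * L.latU w ^ 2) z :=
    (continuousAt_const.mul (hp.pow 2)).add (continuousAt_const.mul (hu.pow 2))
  have hc1 : ContinuousAt
      (fun w => -1 / 2 - L.g₂ * L.latP w * L.latU w - 3 * L.g₃ / 2 * L.latU w ^ 2) z :=
    (continuousAt_const.sub ((continuousAt_const.mul hp).mul hu)).sub
      (continuousAt_const.mul (hu.pow 2))
  have hc2 : ContinuousAt (fun w => -2 * L.g₂ * L.latP w ^ 2 - 3 * L.g₃ * L.latP w * L.latU w) z :=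
    (continuousAt_const.mul (hp.pow 2)).sub ((continuousAt_const.mul hp).mul hu)
  refine ⟨hasDerivAt_of_deriv_eq_nhdsNE hU hc0 ?_, hasDerivAt_of_deriv_eq_nhdsNE hPa hc1 ?_,
    hasDerivAt_of_deriv_eq_nhdsNE hG hc2 ?_⟩
  · filter_upwards [hne] with w hw using (PeriodPair.hasDerivAt_lat_of_notMem hw.1 hw.2).1.deriv
  · filter_upwards [hne] with w hw using (PeriodPair.hasDerivAt_lat_of_notMem hw.1 hw.2).2.1.deriv
  · filter_upwards [hne] with w hw using (PeriodPair.hasDerivAt_lat_of_notMem hw.1 hw.2).2.2.deriv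

/-- The chart equation for `u`. [folklore] -/
theorem _root_.PeriodPair.hasDerivAt_latU {z : ℂ} (h2 : L.univExtP 2 z ≠ 0) :
    HasDerivAt L.latU (-6 * L.latP z ^ 2 + L.g₂ / 2 * L.latU z ^ 2) z :=
  (PeriodPair.hasDerivAt_lat h2).1

/-- The chart equation for `p`. [folklore] -/
theorem _root_.PeriodPair.hasDerivAt_latP {z : ℂ} (h2 : L.univExtP 2 z ≠ 0) :
    HasDerivAt L.latP (-1 / 2 - L.g₂ * L.latP z * L.latU z - 3 * L.g₃ / 2 * L.latU z ^ 2) z :=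
  (PeriodPair.hasDerivAt_lat h2).2.1

/-- The chart equation for `g`. [folklore] -/
theorem _root_.PeriodPair.hasDerivAt_latG {z : ℂ} (h2 : L.univExtP 2 z ≠ 0) :
    HasDerivAt L.latG (-2 * L.g₂ * L.latP z ^ 2 - 3 * L.g₃ * L.latP z * L.latU z) z :=
  (PeriodPair.hasDerivAt_lat h2).2.2

end Literature.NumberTheory.Transcendental

end
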